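import Summits.QuantumFields.BalabanUV.Beta.D1BFx.StraightPinRestRow
import Summits.QuantumFields.BalabanUV.Beta.D1BFx.RoadPinKernelDecay
import Summits.QuantumFields.BalabanUV.Beta.D1BFx.RoadPinKernelBdd

/-!
# `BalabanUV.Beta.D1BFx.StraightPinRestRowMass` — road «BF-x» for binder row D1, slot (K) ∕ junction (J1), PART 24 HEAD row (rest), «REST-ROW-MASS»:
# **an1's PACKED MIXED TABLE `symMixFFAt ρ L` IN `ℓ¹` CURRENCY — ITS FINE-BLOCK × FULL-FIBRE MASS IS AT MOST ITS OWN REFERENCE-BLOCK ABSOLUTE SUM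
# `symMixAbs ρ L` (NO support count, NO power of `L`) — and the HEAD's row (rest) AT THE RECORD re-priced through it: NET `n⁻¹³ × symMixAbs ρ_c n × S × CΦ`
# at an `n`-FREE coarse rate, against the `Zl`-route of `StraightPinRestRow` §4 (three lattice volumes at a FINE rate)**

HONEST DEPENDENCY (cell records, verbatim): «continuum YM on T⁴ ⇐ BetaPertH ∧ nine spine estimates (0/9 proved); BetaPertH ⇐ (D1) ∧ (D4) ∧
CAP+tail; G-an2-4 gates asym, D1 and NE2/3/4.»  HONEST FRAMING (cell contract, verbatim): «discharging `BetaPertH` makes Bałaban's UV stability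
UNCONDITIONAL — a real constructive-QFT result; it is NOT the continuum limit and NOT the Clay problem.»  THIS MODULE DISCHARGES NOTHING of the
wall: [folklore] `Finset` ∕ `tsum` bookkeeping BY NAME over LANDED objects — an1's `SymAveragingMixedJetStructure ∕ …Tables` (`symMixFFAt`, `symTTab`,
`symTTab_eq_zero₁∕₂∕₃` (finite support in all three bonds), `symTTab_eq_zero_block` (block covariance), `symMixAbs = tripleAbs …` (the reference-block
absolute SUM)), lit `AveragingMixedJetTables.nearSet ∕ bondSet ∕ near_zero_iff`, `SymSecondOrderTablesAn1.symTablesAn1S2_mixFF` (`rfl`), lit `BalabanStepW2.M2Of ∕ wM2`,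
this lineage's g62 «K0-REST-ROW» `StraightPinRestRow.restRow_K₀_of_blockSlotTotal` (§5, the table's count FREE), g62 «G0-DECAY» `RoadPinKernelDecay.decays_K₀_of_blocks`
and g63 «G0-BDD» `RoadPinKernelBdd.bdd_G₀_of_decays` (§4 only).  No definition, no `def … : Prop`, nothing
cited, 0 sorry.  The LEG letter `Bdd G S` and the multiplier envelope `hΦ` (the SHAPE of d4-p3's `exists_wΦ_decay`, whose rate `κ₀` is COARSE) stay DISPLAYED
hypotheses; `symMixAbs (ctr 4 n) n` is DISPLAYED and its `n`-law is an1's number — NOT asserted here.  An INTERMEDIATE per-word letter (an2 R-D1-g45-4 (3)): ONE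
displayed row of the HEAD modulo displayed letters, NOT the HEAD; 0 root-level binders of row D1 discharged (hW ∕ hR-sockets ∕ hSX-socket ∕ D1Tel ∕ D1Rep = 0);
(J1) ONE OPEN ROW; (K) NOT closed; NOT D1, NEVER «G-an2-4 closed», NOT `BetaPertH`, NOT continuum, NOT Clay.

ABSOLUTE RULE (cell charter, verbatim): «No internally-minted statement may enter as a cited fact. Every hypothesis is either kernel-proved in
this package or a verbatim quotation of a PUBLISHED theorem with page reference. The manuscript(s) under audit are NOT citable for their own
disputed steps — they are the thing under adjudication; programme-internal (2001/route/tribunal) claims are never citable.»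

WHY (the OWNER d1-p2 g25's OWNER-MEMO-g25 «ROW STATUS BOARD: (rest) IN SHAPE per n — gan24-leaf-05 `StraightPinRestRow` ✓ … THE n-COUNT: sup·Zl currency gives
n^{≥8} per row — m-uniformity needs the mass∕ℓ¹ (packed) currency»; this lineage's g61 C′ «the `Zl`-route prices a finite-range table at n-uniform `δ ≍ 1∕n` with
`≍ n⁸` — a finite-support count is the sharper letter, the row takes either»).  `StraightPinRestRow` §4 fed the (rest) row an1's every-rate SUP letter
`biLoc_symMixFFAt` (constant `symMixAbs·e^{6(d+1)nδ}`, useful only at a FINE rate `δ ≍ 1∕n`) and paid `Zl 4 (δ∕2)³ ≍ n¹²`, a fine-rate second-moment sum `≍ n⁶`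
and the `n⁴` box count.  But an1's constant `symMixAbs ρ L := tripleAbs L (t_sym … 0)` IS ITSELF THE `ℓ¹` TOTAL `Σ_μ Σ_{(f,f′,g) ∈ bondSet³} |t_sym_{(μ,0)}(f,f′;g)|`
of the table over the reference block: summing the packed table's field–field block over the fine sites `u` of a block, the site pair `(x, x′)` and the
fibre, after block covariance and an INJECTIVE re-indexing, is a PARTIAL sum of that total.  So §5's `hPB` socket is inhabited with `T ff = symMixAbs·e^{θ(d+1)}`
at ANY coarse rate `θ` (the background bond sits in the support box of the coarse bond's block: `0 ≤ y₁ − y ≤ 1` coordinatewise), `T = 0` on the other three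
blocks, and the row's constant carries the table ONCE, no lattice volume at a fine rate, no moment sum at a fine rate.

CONTENT.
* §1 [folklore, generic `d`, root offset `r ∈ box (d+1) L`]: `blk_symMixFFAt_eq_zero` (off ff), `blk_symMixFFAt_tt` (`rfl`), `mem_image_nearSet` (the support box of
  the block `y` as `nearSet.image (· + L•y)`), `fibreMass_blk_symMixFFAt_eq_zero` (finite support in the site pair), **`summable_fibreMass_blk_symMixFFAt`** (§5's `hPs`),
  `tsum_fibreMass_blk_symMixFFAt_eq`, **`boxSum_fibreMass_tt_le_symMixAbs`** (`Σ_{b ∈ box} Σ_{(x,x′) ∈ near(y)²} Σ_{α α′} |t_sym_{(μ,y)}((α,x),(α′,x′);(κ, L•y₁ + b))|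
  ≤ symMixAbs ρ L` — `Finset.sum_image` on the injection `(b,x,x′,α,α′) ↦ ((α,x−L•y),(α′,x′−L•y),(κ,L•(y₁−y)+b))`, `sum_filter_of_ne` + `symTTab_eq_zero₃`,
  `sum_le_sum_of_subset_of_nonneg`, `single_le_sum` over `μ`), `l1_le_of_near_block` (`Near L y (L•y₁ + b)`, `b ∈ box` ⟹ `|y − y₁|₁ ≤ d + 1`),
  **`boxSum_tsum_fibreMass_blk_symMixFFAt_le`** (§5's `hPB` shape: `≤ (if j ∧ i then symMixAbs·e^{θ(d+1)} else 0)·e^{−θ|y − y₁|₁}`, any `0 ≤ θ`).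
* §2 [`d = 3`, the record, `[NeZero n]`]: `M2_record_eq` (`wM2 3 n 0 = 1`, so `M₂⁰ = symMixFFAt (toSite (ctrOff 4 n)) n`), **`hPs_record`**, **`hPB_record`**.
* §4 **`restRow_head`**: §3 at the HEAD's literal leg `G := G₀ = coDressKBmAt (ctr 4 n) n K₀` with `hG := RoadPinKernelBdd.bdd_G₀_of_decays n (RoadPinKernelDecay.decays_K₀_of_blocks n …)`
  BY TERM — `S = (1 + 16n)²·(CΓ + 2·(n⁵)⁻¹C₄e^{κ′} + CΦ(n⁵)⁻¹(n³)⁻¹e^{κ₀})`; the ONLY displayed letters left are `hΓ` (sup + decay of the ff block, `0 ≤ δΓ`) and `hΦ`.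
* §3 **`restRow_record_mass`**: the HEAD's binder shapes `(∀ a e, AbsMoment₂ (Wrest a e)) ∧ |secondMoment Wrest μ ν| ≤ ½·(S·(2·K^{mix}_{K₀}(θ)·(symMixAbs ρ_c n·e^{4θ})))·
  Σ'_x |x|₁² e^{−min (m₀∕8) (θ∕2)|x|₁}` for `Wrest a e z = ½·tadpole G (mixOfK K₀ n M₂⁰ a 0 e z + mixOfK K₀ n M₂⁰ e z a 0)` — the SAME word as `StraightPinRestRow.restRow_record`,
  `K^{mix}_{K₀}(θ) = (n⁵)⁻¹·((n⁵)⁻¹·(n³)⁻¹)·(16·C₄e^{κ′}·CΦe^{κ₀}·e^{m₀}·e^{m₀}·Zl 4 (m₀∕8)·Zl 4 (θ∕2))`, `m₀ = min κ′ κ₀`, `κ′ = kappa163 4∕4`; every factor DISPLAYED.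
NOT HERE (honest): the `n`-law of `symMixAbs (ctr 4 n) n` (an1's; a by-value reading is a calc-desk request, not a theorem of this file); the leg letter `Bdd G₀ S`
with a displayed `S` (g62 «G0-DECAY» `RoadPinKernelDecay.decays_G₀_record` + lit `bdd_of_decays`, modulo `hΓ`); the identity (rest) = straight mixed pair (the OWNER's
`ChartDefectTwoPinsRest` (i)); the other seven rows; m-uniformity itself (it holds exactly when `S·CΦ·symMixAbs ρ_c n ≲ n¹³`).
Unit `b2b-balaban-gan24-formalise-leaf-05` (gen 63), G-an2-4 swarm leaf prover 05, road «BF-x» supplier; INTENT-2 «REST-ROW-MASS» (journal).  No existing file touched.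
-/

noncomputable section

open Finset
open scoped BigOperators
open Literature.MathematicalPhysics.QuantumFieldTheory
open Literature.MathematicalPhysics.QuantumFieldTheory.Balaban1983to89
open Literature.MathematicalPhysics.QuantumFieldTheory.Balaban1983to89.Beta
open B12Sec2to5 (l1 l1_nonneg)
open DecimatedMomentSummable (AbsMoment₂)
open B4ContourShift (supNorm)
open B5Hk163Strip (kappa163 kappa163_pos)
open B5Hk163Decay (MG163)
open B4TorusKernel (periodConst)
open ExpKernelCalculus (Site MKer Zl tadpole)
open AffineAveraging (box toSite)
open AveragingContoursRooted (ctr ctrOff ctrOff_mem_box)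
open AveragingHessianKernels (Near Bond)
open AveragingMixedJetTables (nearSet bondSet mem_nearSet mem_bondSet near_zero_iff)
open KernelSpecInstance (wΦ)
open KernelWard (Bdd)
open OneStepResolventKernel (Fib)
open OneStepKernelFamily (KInvStep)
open SecondOrderResponse (mixOfK)
open BalabanStepW2 (M2Of wM2)
open Summit.QuantumFields.BalabanUV.Beta.SymAveragingMixedJetTables (symMixFFAt symMixAbs symTTab tripleAbs symTTab_eq_zero₁ symTTab_eq_zero₂
  symTTab_eq_zero₃ symTTab_eq_zero_block symMixAbs_nonneg symMixFFAt_inl_inl symMixFFAt_inl_inr symMixFFAt_inr symMixKerAt)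
open Summit.QuantumFields.BalabanUV.Beta.SymSecondOrderTablesAn1 (symTablesAn1S2 symTablesAn1S2_mixFF)
open Summit.QuantumFields.BalabanUV.Beta.D1BFx.PackedKernelSplit (blk blk_tt blk_tf blk_ft blk_ff)
open Summit.QuantumFields.BalabanUV.Beta.D1BFx.StraightPinRestRow (restRow_K₀_of_blockSlotTotal)
open KKTFluctuationKernel (Gam)
open Summit.QuantumFields.BalabanUV.Beta.AxialDressingRooted (coDressKBmAt)
open Summit.QuantumFields.BalabanUV.Beta.D1BFx.RoadPinKernelDecay (decays_K₀_of_blocks)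
open Summit.QuantumFields.BalabanUV.Beta.D1BFx.RoadPinKernelBdd (bdd_G₀_of_decays)

namespace Summit.QuantumFields.BalabanUV.Beta.D1BFx.StraightPinRestRowMass

/-! ## §1 an1's packed mixed table `symMixFFAt` in `ℓ¹` currency (generic `d`, root offset `r ∈ box`) -/

section Table

variable {d : ℕ} {r : Fin (d + 1) → ℕ} {L : ℕ}

/-- [folklore] Off the field–field block the packed mixed table vanishes. -/
theorem blk_symMixFFAt_eq_zero (ρ : Fin (d + 1) → ℤ) (L : ℕ) (κ : Fin (d + 1)) (u : Fin (d + 1) → ℤ) (μ : Fin (d + 1)) (y : Fin (d + 1) → ℤ)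
    {j i : Bool} (h : ¬ (j = true ∧ i = true)) : blk (symMixFFAt ρ L κ u μ y) j i = 0 := by
  funext x x' a b
  cases j <;> cases i
  · rfl
  · rfl
  · rfl
  · exact absurd ⟨rfl, rfl⟩ h

/-- [folklore] The field–field block of the packed mixed table, entrywise: `t_sym_{(μ,y)}((α,x),(α′,x′);(κ,u))`. -/
theorem blk_symMixFFAt_tt (ρ : Fin (d + 1) → ℤ) (L : ℕ) (κ : Fin (d + 1)) (u : Fin (d + 1) → ℤ) (μ : Fin (d + 1)) (y : Fin (d + 1) → ℤ)
    (x x' : Fin (d + 1) → ℤ) (α α' : Fin (d + 1)) :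
    blk (symMixFFAt ρ L κ u μ y) true true x x' α α' = (symTTab ρ L μ y (α, x) (α', x') (κ, u) : ℝ) := rfl

/-- [folklore] The support box of the block `y`, as a `Finset`: the translate of `nearSet` by `L•y`. -/
theorem mem_image_nearSet {y x : Fin (d + 1) → ℤ} :
    x ∈ (nearSet (d + 1) L).image (fun x₀ => x₀ + (L : ℤ) • y) ↔ Near L y x := by
  constructor
  · rintro hx
    obtain ⟨x₀, hx₀, rfl⟩ := Finset.mem_image.1 hx
    have h := mem_nearSet.1 hx₀
    rw [← near_zero_iff (y := y)]
    simpa using h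
  · intro hx
    refine Finset.mem_image.2 ⟨x + -((L : ℤ) • y), mem_nearSet.2 (near_zero_iff.2 hx), ?_⟩
    simp

/-- [folklore] **THE PACKED MIXED TABLE HAS FINITE SUPPORT IN THE SITE PAIR** (an1's `symTTab_eq_zero₁ ∕ ₂`): the fibre mass of any block vanishes off
`near(y) × near(y)`. -/
theorem fibreMass_blk_symMixFFAt_eq_zero (hr : r ∈ box (d + 1) L) (κ : Fin (d + 1)) (u : Fin (d + 1) → ℤ) (μ : Fin (d + 1))
    (y : Fin (d + 1) → ℤ) (j i : Bool) {p : Site (d + 1) × Site (d + 1)}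
    (hp : p ∉ (nearSet (d + 1) L).image (fun x₀ => x₀ + (L : ℤ) • y) ×ˢ (nearSet (d + 1) L).image (fun x₀ => x₀ + (L : ℤ) • y)) :
    ∑ g : Fin (d + 1), ∑ f : Fin (d + 1), |blk (symMixFFAt (toSite r) L κ u μ y) j i p.1 p.2 g f| = 0 := by
  by_cases hji : j = true ∧ i = true
  · obtain ⟨rfl, rfl⟩ := hji
    rw [Finset.mem_product, not_and_or, mem_image_nearSet, mem_image_nearSet] at hp
    refine Finset.sum_eq_zero fun g _ => Finset.sum_eq_zero fun f _ => ?_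
    rw [blk_symMixFFAt_tt]
    rcases hp with h1 | h2
    · rw [symTTab_eq_zero₁ hr μ y (f := (g, p.1)) h1, Rat.cast_zero, abs_zero]
    · rw [symTTab_eq_zero₂ hr μ y _ (f' := (f, p.2)) h2, Rat.cast_zero, abs_zero]
  · simp [blk_symMixFFAt_eq_zero (toSite r) L κ u μ y hji]

/-- [folklore] **SUMMABILITY** of every block's fibre mass of the packed mixed table (finite support) — the `hPs` socket of
`StraightPinRestRow.restRow_K₀_of_blockSlotTotal`. -/
theorem summable_fibreMass_blk_symMixFFAt (hr : r ∈ box (d + 1) L) (κ : Fin (d + 1)) (u : Fin (d + 1) → ℤ) (μ : Fin (d + 1))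
    (y : Fin (d + 1) → ℤ) (j i : Bool) :
    Summable fun p : Site (d + 1) × Site (d + 1) => ∑ g : Fin (d + 1), ∑ f : Fin (d + 1), |blk (symMixFFAt (toSite r) L κ u μ y) j i p.1 p.2 g f| :=
  summable_of_ne_finset_zero fun _ hp => fibreMass_blk_symMixFFAt_eq_zero hr κ u μ y j i hp

/-- [folklore] The full fibre mass of a block of the packed mixed table is the finite sum over `near(y) × near(y)`. -/
theorem tsum_fibreMass_blk_symMixFFAt_eq (hr : r ∈ box (d + 1) L) (κ : Fin (d + 1)) (u : Fin (d + 1) → ℤ) (μ : Fin (d + 1))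
    (y : Fin (d + 1) → ℤ) (j i : Bool) :
    ∑' p : Site (d + 1) × Site (d + 1), ∑ g : Fin (d + 1), ∑ f : Fin (d + 1), |blk (symMixFFAt (toSite r) L κ u μ y) j i p.1 p.2 g f|
      = ∑ p ∈ (nearSet (d + 1) L).image (fun x₀ => x₀ + (L : ℤ) • y) ×ˢ (nearSet (d + 1) L).image (fun x₀ => x₀ + (L : ℤ) • y),
          ∑ g : Fin (d + 1), ∑ f : Fin (d + 1), |blk (symMixFFAt (toSite r) L κ u μ y) j i p.1 p.2 g f| :=
  tsum_eq_sum fun _ hp => fibreMass_blk_symMixFFAt_eq_zero hr κ u μ y j i hp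

/-- [folklore] **THE FINE-BLOCK × FULL-FIBRE MASS OF THE FIELD–FIELD BLOCK IS AT MOST an1's REFERENCE-BLOCK ABSOLUTE SUM `symMixAbs`** — read as what it IS,
an `ℓ¹` total (`tripleAbs = Σ_μ Σ_{(f,f′,g) ∈ bondSet³} |t_sym_{(μ,0)}(f,f′;g)|`), NOT as an entrywise bound: for every coarse site `y₁`,
`Σ_{b ∈ box} Σ_{(x,x′) ∈ near(y)²} Σ_{α α′} |t_sym_{(μ,y)}((α,x),(α′,x′);(κ, L•y₁ + b))| ≤ symMixAbs ρ L` (block covariance `symTTab_eq_zero_block` to the block `0`;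
the map `(b, x, x′, α, α′) ↦ ((α, x − L•y), (α′, x′ − L•y), (κ, L•(y₁ − y) + b))` is injective; terms with the background bond off the support box vanish by
`symTTab_eq_zero₃`). NO support count enters. -/
theorem boxSum_fibreMass_tt_le_symMixAbs (hr : r ∈ box (d + 1) L) (κ : Fin (d + 1)) (μ : Fin (d + 1)) (y₁ y : Fin (d + 1) → ℤ) :
    ∑ b ∈ box (d + 1) L,
        ∑ p ∈ (nearSet (d + 1) L).image (fun x₀ => x₀ + (L : ℤ) • y) ×ˢ (nearSet (d + 1) L).image (fun x₀ => x₀ + (L : ℤ) • y),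
          ∑ g : Fin (d + 1), ∑ f : Fin (d + 1), |blk (symMixFFAt (toSite r) L κ ((L : ℤ) • y₁ + toSite b) μ y) true true p.1 p.2 g f|
      ≤ symMixAbs (toSite r) L := by
  classical
  -- the index set and the injection into bond triples at the block `0`
  set NS : Finset (Site (d + 1)) := (nearSet (d + 1) L).image (fun x₀ => x₀ + (L : ℤ) • y) with hNS
  set I : Finset ((Fin (d + 1) → ℕ) × ((Site (d + 1) × Site (d + 1)) × (Fin (d + 1) × Fin (d + 1)))) :=
    box (d + 1) L ×ˢ ((NS ×ˢ NS) ×ˢ (Finset.univ ×ˢ Finset.univ)) with hI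
  let Φ : (Fin (d + 1) → ℕ) × ((Site (d + 1) × Site (d + 1)) × (Fin (d + 1) × Fin (d + 1))) → (Bond (d + 1) × Bond (d + 1)) × Bond (d + 1) :=
    fun q => (((q.2.2.1, q.2.1.1 + -((L : ℤ) • y)), (q.2.2.2, q.2.1.2 + -((L : ℤ) • y))), (κ, (L : ℤ) • y₁ + toSite q.1 + -((L : ℤ) • y)))
  let T : (Bond (d + 1) × Bond (d + 1)) × Bond (d + 1) → ℝ := fun t => |(symTTab (toSite r) L μ 0 t.1.1 t.1.2 t.2 : ℝ)|
  have hT0 : ∀ t, 0 ≤ T t := fun t => abs_nonneg _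
  -- Step 1: the nested sum is the sum of `T ∘ Φ` over `I`
  have h1 : ∑ b ∈ box (d + 1) L, ∑ p ∈ NS ×ˢ NS,
        ∑ g : Fin (d + 1), ∑ f : Fin (d + 1), |blk (symMixFFAt (toSite r) L κ ((L : ℤ) • y₁ + toSite b) μ y) true true p.1 p.2 g f|
      = ∑ q ∈ I, T (Φ q) := by
    symm
    simp only [hI, Finset.sum_product, T, Φ]
    refine Finset.sum_congr rfl fun b _ => Finset.sum_congr rfl fun x _ => Finset.sum_congr rfl fun x' _ => ?_
    refine Finset.sum_congr rfl fun g _ => Finset.sum_congr rfl fun f _ => ?_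
    conv_rhs => rw [blk_symMixFFAt_tt, symTTab_eq_zero_block]
    rfl
  -- Step 2: `Φ` is injective on `I`
  have hinj : Set.InjOn Φ ↑I := by
    rintro ⟨b, ⟨x, x'⟩, ⟨α, α'⟩⟩ _ ⟨b₂, ⟨x₂, x₂'⟩, ⟨α₂, α₂'⟩⟩ _ h
    simp only [Φ, Prod.mk.injEq] at h
    obtain ⟨⟨⟨hα, hx⟩, ⟨hα', hx'⟩⟩, -, hb⟩ := h
    have hx2 : x = x₂ := by simpa using hx
    have hx2' : x' = x₂' := by simpa using hx'
    have hb2 : toSite b = toSite b₂ := by simpa using hb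
    have hb3 : b = b₂ := by
      funext i
      have := congrFun hb2 i
      simp only [toSite] at this
      exact_mod_cast this
    subst hα; subst hα'; subst hx2; subst hx2'; subst hb3
    rfl
  -- Step 3: sum over the image, drop the terms off `bondSet³`, compare with `tripleAbs`
  have h2 : ∑ q ∈ I, T (Φ q) = ∑ t ∈ I.image Φ, T t := (Finset.sum_image hinj).symm
  have h3 : ∑ t ∈ I.image Φ, T t = ∑ t ∈ (I.image Φ).filter (fun t => t ∈ (bondSet (d + 1) L ×ˢ bondSet (d + 1) L) ×ˢ bondSet (d + 1) L), T t := by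
    refine (Finset.sum_filter_of_ne fun t ht hne => ?_).symm
    obtain ⟨q, hq, rfl⟩ := Finset.mem_image.1 ht
    rw [hI, Finset.mem_product, Finset.mem_product, Finset.mem_product] at hq
    obtain ⟨hb, ⟨hx, hx'⟩, -⟩ := hq
    rw [hNS, mem_image_nearSet] at hx hx'
    simp only [Finset.mem_product, mem_bondSet, Φ]
    refine ⟨⟨near_zero_iff.2 hx, near_zero_iff.2 hx'⟩, ?_⟩
    by_contra hg
    exact hne (by simp only [T, Φ]; rw [symTTab_eq_zero₃ hr μ 0 _ _ hg, Rat.cast_zero, abs_zero])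
  have h4 : ∑ t ∈ (I.image Φ).filter (fun t => t ∈ (bondSet (d + 1) L ×ˢ bondSet (d + 1) L) ×ˢ bondSet (d + 1) L), T t
      ≤ ∑ t ∈ (bondSet (d + 1) L ×ˢ bondSet (d + 1) L) ×ˢ bondSet (d + 1) L, T t :=
    Finset.sum_le_sum_of_subset_of_nonneg (fun t ht => (Finset.mem_filter.1 ht).2) fun t _ _ => hT0 t
  have h5 : ∑ t ∈ (bondSet (d + 1) L ×ˢ bondSet (d + 1) L) ×ˢ bondSet (d + 1) L, T t ≤ symMixAbs (toSite r) L := by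
    rw [symMixAbs, tripleAbs]
    exact Finset.single_le_sum (f := fun ν : Fin (d + 1) => ∑ t ∈ (bondSet (d + 1) L ×ˢ bondSet (d + 1) L) ×ˢ bondSet (d + 1) L,
      |(symTTab (toSite r) L ν 0 t.1.1 t.1.2 t.2 : ℝ)|) (fun _ _ => Finset.sum_nonneg fun _ _ => abs_nonneg _) (Finset.mem_univ μ)
  rw [← hNS] at *
  rw [h1, h2, h3]
  exact h4.trans h5

/-- [folklore] **WHERE THE BACKGROUND BOND CAN SIT**: if a fine site of the block `y₁` lies in the support box of the block `y`, then `0 ≤ y₁ − y ≤ 1`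
coordinatewise, so `|y − y₁|₁ ≤ d + 1`. -/
theorem l1_le_of_near_block (hL : 1 ≤ L) {y₁ y : Fin (d + 1) → ℤ} {b : Fin (d + 1) → ℕ} (hb : b ∈ box (d + 1) L)
    (h : Near L y ((L : ℤ) • y₁ + toSite b)) : l1 (y - y₁) ≤ (d : ℝ) + 1 := by
  have hb' : ∀ i, b i < L := by simpa [AffineAveraging.box, Fintype.mem_piFinset, Finset.mem_range] using hb
  have hc : ∀ i, |((y - y₁) i : ℝ)| ≤ 1 := by
    intro i
    obtain ⟨h1, h2⟩ := h i
    have hi := hb' i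
    simp only [Pi.add_apply, Pi.smul_apply, smul_eq_mul, toSite] at h1 h2
    have hL0 : (0 : ℤ) < L := by exact_mod_cast hL
    have k1 : 0 ≤ y₁ i - y i := by
      by_contra hk; push Not at hk
      have : (L : ℤ) * y₁ i + b i < L * y i := by nlinarith
      omega
    have k2 : y₁ i - y i ≤ 1 := by
      by_contra hk; push Not at hk
      have : (L : ℤ) * y i + (2 * L - 1) < L * y₁ i + b i := by nlinarith
      omega
    rw [Pi.sub_apply, show (((y i - y₁ i : ℤ)) : ℝ) = -((y₁ i - y i : ℤ) : ℝ) by push_cast; ring, abs_neg]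
    rw [abs_le]; norm_cast; constructor <;> omega
  calc l1 (y - y₁) = ∑ i : Fin (d + 1), |((y - y₁) i : ℝ)| := rfl
    _ ≤ ∑ _i : Fin (d + 1), (1 : ℝ) := Finset.sum_le_sum fun i _ => hc i
    _ = (d : ℝ) + 1 := by simp

/-- [folklore] **THE `hPB` SOCKET FOR an1's PACKED MIXED TABLE, WITH THE TABLE's OWN TOTAL** (any root offset in the box, any `0 ≤ θ`): for every fine direction `κ`, coarse bond
`(μ, y)`, coarse site `y₁` and block `(j, i)`,
`Σ_{b ∈ box} Σ'_{(x,x′)} Σ_{g f} |blk (symMixFFAt ρ L κ (L•y₁ + b) μ y) j i x x′ g f| ≤ (if j ∧ i then symMixAbs ρ L·e^{θ(d+1)} else 0)·e^{−θ|y − y₁|₁}`. -/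
theorem boxSum_tsum_fibreMass_blk_symMixFFAt_le (hL : 1 ≤ L) (hr : r ∈ box (d + 1) L) {θ : ℝ} (hθ : 0 ≤ θ) (κ μ : Fin (d + 1))
    (y₁ y : Fin (d + 1) → ℤ) (j i : Bool) :
    ∑ b ∈ box (d + 1) L, (∑' p : Site (d + 1) × Site (d + 1),
        ∑ g : Fin (d + 1), ∑ f : Fin (d + 1), |blk (symMixFFAt (toSite r) L κ ((L : ℤ) • y₁ + toSite b) μ y) j i p.1 p.2 g f|)
      ≤ (if j = true ∧ i = true then symMixAbs (toSite r) L * Real.exp (θ * ((d : ℝ) + 1)) else 0) * Real.exp (-θ * l1 (y - y₁)) := by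
  by_cases hji : j = true ∧ i = true
  · obtain ⟨rfl, rfl⟩ := hji
    rw [if_pos ⟨rfl, rfl⟩]
    simp_rw [tsum_fibreMass_blk_symMixFFAt_eq hr]
    by_cases H : ∃ b ∈ box (d + 1) L, Near L y ((L : ℤ) • y₁ + toSite b)
    · obtain ⟨b₀, hb₀, hnear⟩ := H
      have hd := l1_le_of_near_block hL hb₀ hnear
      have hA := symMixAbs_nonneg (toSite r) L
      have hexp : 1 ≤ Real.exp (θ * ((d : ℝ) + 1)) * Real.exp (-θ * l1 (y - y₁)) := by
        rw [← Real.exp_add]; exact Real.one_le_exp (by nlinarith)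
      calc _ ≤ symMixAbs (toSite r) L := boxSum_fibreMass_tt_le_symMixAbs hr κ μ y₁ y
        _ ≤ symMixAbs (toSite r) L * (Real.exp (θ * ((d : ℝ) + 1)) * Real.exp (-θ * l1 (y - y₁))) := le_mul_of_one_le_right hA hexp
        _ = _ := by ring
    · push Not at H
      have h0 : ∑ b ∈ box (d + 1) L,
          ∑ p ∈ (nearSet (d + 1) L).image (fun x₀ => x₀ + (L : ℤ) • y) ×ˢ (nearSet (d + 1) L).image (fun x₀ => x₀ + (L : ℤ) • y),
            ∑ g : Fin (d + 1), ∑ f : Fin (d + 1), |blk (symMixFFAt (toSite r) L κ ((L : ℤ) • y₁ + toSite b) μ y) true true p.1 p.2 g f| = 0 := by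
        refine Finset.sum_eq_zero fun b hb => Finset.sum_eq_zero fun p _ => Finset.sum_eq_zero fun g _ => Finset.sum_eq_zero fun f _ => ?_
        rw [blk_symMixFFAt_tt, symTTab_eq_zero₃ hr μ y _ _ (g := (κ, (L : ℤ) • y₁ + toSite b)) (H b hb), Rat.cast_zero, abs_zero]
      rw [h0]
      exact mul_nonneg (mul_nonneg (symMixAbs_nonneg _ _) (Real.exp_pos _).le) (Real.exp_pos _).le
  · rw [if_neg hji, zero_mul]
    refine le_of_eq (Finset.sum_eq_zero fun b _ => ?_)
    simp [blk_symMixFFAt_eq_zero (toSite r) L κ _ μ y hji]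

end Table

/-! ## §2 `d = 3`, the record: `M₂⁰ := M2Of 3 n (symTablesAn1S2 3 n cΛ).mixFF 0 = symMixFFAt ρ_c n` (weight `wM2 3 n 0 = 1`) — the `hPs ∕ hPB` sockets of
`StraightPinRestRow.restRow_K₀_of_blockSlotTotal` INHABITED with the table's own total `symMixAbs ρ_c n` -/

section Record

variable (n : ℕ) [NeZero n]

/-- [folklore] **THE RECORD's MIXED TABLE IS an1's PACKED SYMMETRISED TABLE AT THE CENTRED ROOT**: `M2Of 3 n (symTablesAn1S2 3 n cΛ).mixFF 0 κ u ρ w = symMixFFAt (toSite (ctrOff 4 n)) n κ u ρ w`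
(the step-`0` weight `wM2 3 n 0 = ((n)^0)^{15} = 1` — sibling of `WardMixedModelNoGo.M2Of_zero`, not in this file's import closure; `symTablesAn1S2_mixFF` is `rfl`;
`ctr 4 n = toSite (ctrOff 4 n)` is `rfl`). -/
theorem M2_record_eq (cΛ : ℝ) (κ : Fin (3 + 1)) (u : Fin (3 + 1) → ℤ) (ρ : Fin (3 + 1)) (w : Fin (3 + 1) → ℤ) :
    M2Of 3 n (symTablesAn1S2 3 n cΛ).mixFF 0 κ u ρ w = symMixFFAt (toSite (ctrOff 4 n)) n κ u ρ w := by
  show wM2 3 n 0 • (symTablesAn1S2 3 n cΛ).mixFF κ u ρ w = _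
  rw [show wM2 3 n 0 = 1 by simp [wM2], one_smul, symTablesAn1S2_mixFF]; rfl

/-- [folklore] **`hPs` AT THE RECORD**: every block's fibre mass of the record's mixed table is summable in the site pair (finite support). -/
theorem hPs_record (cΛ : ℝ) :
    ∀ (κ : Fin (3 + 1)) (u : Fin (3 + 1) → ℤ) (ρ' : Fin (3 + 1)) (w : Fin (3 + 1) → ℤ) (j i : Bool),
      Summable fun p : Site 4 × Site 4 => ∑ g, ∑ f, |blk (M2Of 3 n (symTablesAn1S2 3 n cΛ).mixFF 0 κ u ρ' w) j i p.1 p.2 g f| := by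
  intro κ u ρ' w j i
  simp_rw [M2_record_eq]
  exact summable_fibreMass_blk_symMixFFAt (ctrOff_mem_box (Nat.one_le_iff_ne_zero.2 (NeZero.ne n))) κ u ρ' w j i

/-- [folklore] **`hPB` AT THE RECORD, WITH THE TABLE's OWN TOTAL** (`0 ≤ θ` free): for every fine direction `κ`, coarse bond `(ρ′, w)`, coarse site `y₁`, block `(j, i)`,
`Σ_{b ∈ box 4 n} Σ'_{(x,x′)} Σ_{g f} |blk (M₂⁰ κ (n•y₁ + b) ρ′ w) j i x x′ g f| ≤ T j i · e^{−θ|w − y₁|₁}`, **`T j i := if j ∧ i then symMixAbs ρ_c n·e^{4θ} else 0`** —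
NO support count, NO power of `n` beyond what `symMixAbs ρ_c n` itself carries. -/
theorem hPB_record (cΛ : ℝ) {θ : ℝ} (hθ : 0 ≤ θ) :
    ∀ (κ ρ' : Fin (3 + 1)) (y₁ w : Fin (3 + 1) → ℤ) (j i : Bool), ∑ b ∈ box (3 + 1) n,
      (∑' p : Site 4 × Site 4, ∑ g, ∑ f, |blk (M2Of 3 n (symTablesAn1S2 3 n cΛ).mixFF 0 κ ((n : ℤ) • y₁ + toSite b) ρ' w) j i p.1 p.2 g f|)
        ≤ (if j = true ∧ i = true then symMixAbs (ctr 4 n) n * Real.exp (θ * ((3 : ℝ) + 1)) else 0) * Real.exp (-θ * l1 (w - y₁)) := by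
  intro κ ρ' y₁ w j i
  simp_rw [M2_record_eq]
  exact boxSum_tsum_fibreMass_blk_symMixFFAt_le (Nat.one_le_iff_ne_zero.2 (NeZero.ne n)) (ctrOff_mem_box (Nat.one_le_iff_ne_zero.2 (NeZero.ne n)))
    hθ κ ρ' y₁ w j i

/-! ## §3 The (rest) row AT THE RECORD on the MASS route: the table priced by its own total, coarse rate `n`-FREE -/

/-- [our objects + folklore] **«REST-ROW-MASS» — THE HEAD's ROW (rest) AT THE RECORD WITH THE TABLE COUNT READ IN `ℓ¹`** (modulo the displayed leg letter `Bdd G S`, `0 ≤ S`,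
the multiplier envelope `hΦ` (the SHAPE of d4-p3's `exists_wΦ_decay`, `κ₀` a COARSE rate), `cΛ`, and a free coarse rate `0 < θ`): for
`Wrest a e z := ½·tadpole G (mixOfK K₀ n M₂⁰ a 0 e z + mixOfK K₀ n M₂⁰ e z a 0)`, `M₂⁰ := M2Of 3 n (symTablesAn1S2 3 n cΛ).mixFF 0`,
(i) `∀ a e, AbsMoment₂ (Wrest a e)`; (ii) `|secondMoment Wrest μ ν| ≤ ½·(S·(2·K^{mix}_{K₀}(θ)·(symMixAbs ρ_c n·e^{4θ})))·Σ'_x |x|₁² e^{−min (m₀∕8) (θ∕2)|x|₁}`,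
`K^{mix}_{K₀}(θ) = (n⁵)⁻¹·((n⁵)⁻¹·(n³)⁻¹)·(16·C₄e^{κ′}·CΦe^{κ₀}·e^{m₀}·e^{m₀}·Zl 4 (m₀∕8)·Zl 4 (θ∕2))`, `m₀ = min κ′ κ₀`, `κ′ = kappa163 4∕4` — `StraightPinRestRow.restRow_K₀_of_blockSlotTotal`
fed with §2.  NET `n⁻¹³ × symMixAbs ρ_c n × S × CΦ ×` n-FREE numbers at an n-FREE rate (all of `κ′, κ₀, θ` are coarse): against §4 of `StraightPinRestRow` (the `Zl`-route through
an1's every-rate sup letter at a FINE rate `δ ≍ 1∕n`: `Zl 4 (δ∕2)³·e^{24nδ}·n⁴` and a fine-rate moment sum), the table now enters through its reference-block absolute sum ONCE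
and nothing else of it.  The n-law of `symMixAbs (ctr 4 n) n` is an1's number and is NOT asserted here; the row is m-uniform exactly when `S·CΦ·symMixAbs ρ_c n ≲ n¹³`. -/
theorem restRow_record_mass {G : MKer 4 (Fib 3)} {S : ℝ} (hG : Bdd G S) (hS : 0 ≤ S) {CΦ κ₀ : ℝ} (hκ₀ : 0 < κ₀)
    (hΦ : ∀ (ρ ν : Fin (3 + 1)) (w : Fin (3 + 1) → ℤ),
      |wΦ (N := n) ρ ν w| ≤ CΦ * ((n : ℝ) ^ 5)⁻¹ * ((n : ℝ) ^ 3)⁻¹ * Real.exp (-(κ₀ * supNorm w)))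
    (cΛ : ℝ) {θ : ℝ} (hθ : 0 < θ) (μ ν : Fin (3 + 1)) :
    (∀ a e : Fin (3 + 1), AbsMoment₂ (fun z : Site 4 => (1 / 2 : ℝ) * tadpole G
        (mixOfK (KInvStep (d := 3) n 0) n (M2Of 3 n (symTablesAn1S2 3 n cΛ).mixFF 0) a 0 e z
          + mixOfK (KInvStep (d := 3) n 0) n (M2Of 3 n (symTablesAn1S2 3 n cΛ).mixFF 0) e z a 0))) ∧
      |B12Beta.secondMoment (fun (a e : Fin (3 + 1)) (z : Site 4) => (1 / 2 : ℝ) * tadpole G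
          (mixOfK (KInvStep (d := 3) n 0) n (M2Of 3 n (symTablesAn1S2 3 n cΛ).mixFF 0) a 0 e z
            + mixOfK (KInvStep (d := 3) n 0) n (M2Of 3 n (symTablesAn1S2 3 n cΛ).mixFF 0) e z a 0)) μ ν|
        ≤ ((1 / 2 : ℝ) * (S * (2 * ((((n : ℝ) ^ 5)⁻¹ * (((n : ℝ) ^ 5)⁻¹ * ((n : ℝ) ^ 3)⁻¹))
            * (16 * ((MG163 4 * periodConst (kappa163 4) 3) * Real.exp (kappa163 4 / 4)) * (CΦ * Real.exp κ₀)
                * Real.exp (min (kappa163 4 / 4) κ₀) * Real.exp (min (kappa163 4 / 4) κ₀)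
                * Zl 4 (min (kappa163 4 / 4) κ₀ / 8) * Zl 4 (θ / 2)))
            * (symMixAbs (ctr 4 n) n * Real.exp (θ * ((3 : ℝ) + 1))))))
          * ∑' x : Site 4, l1 x ^ 2 * Real.exp (-(min (min (kappa163 4 / 4) κ₀ / 8) (θ / 2)) * l1 x) := by
  set T : Bool → Bool → ℝ := fun j i => if j = true ∧ i = true then symMixAbs (ctr 4 n) n * Real.exp (θ * ((3 : ℝ) + 1)) else 0 with hT
  have hPB : ∀ (κ ρ' : Fin (3 + 1)) (y₁ w : Fin (3 + 1) → ℤ) (j i : Bool), ∑ b ∈ box (3 + 1) n,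
      (∑' p : Site 4 × Site 4, ∑ g, ∑ f, |blk (M2Of 3 n (symTablesAn1S2 3 n cΛ).mixFF 0 κ ((n : ℤ) • y₁ + toSite b) ρ' w) j i p.1 p.2 g f|)
        ≤ T j i * Real.exp (-θ * l1 (w - y₁)) := hPB_record n cΛ hθ.le
  have h := restRow_K₀_of_blockSlotTotal n hG hS hκ₀ hΦ hθ (hPs_record n cΛ) hPB μ ν
  have e : (T true true + T true false) + (T false true + T false false) = symMixAbs (ctr 4 n) n * Real.exp (θ * ((3 : ℝ) + 1)) := by
    simp [hT]
  rw [e] at h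
  exact h

/-! ## §4 The (rest) row AT THE HEAD's LITERAL LEG `G₀ := coDressKBmAt (ctr 4 n) n K₀`: every constant CLOSED modulo the ff letter `hΓ` and `hΦ` -/

/-- [our objects + folklore] **«REST-ROW-HEAD» — THE HEAD's ROW (rest) AT ITS OWN LEG, ALL SOCKETS FED BY TERM** (modulo the (K)-wall's ff letter `hΓ` (sup + decay of `Γ^{(n)}`, `0 ≤ CΓ`,
`0 ≤ δΓ`), the multiplier envelope `hΦ`, `cΛ`, and a free coarse rate `0 < θ`): §3 `restRow_record_mass` with the leg letter `hG := bdd_G₀_of_decays n (decays_K₀_of_blocks n …)`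
(g63 «G0-BDD» over g62 «G0-DECAY»'s block letter): `S = (1 + 4·(4·n))²·(CΓ + 2·(n⁵)⁻¹C₄e^{κ′} + CΦ(n⁵)⁻¹(n³)⁻¹e^{κ₀})`.  NET `n⁻¹³·(1+16n)²·(CΓ + …)·symMixAbs ρ_c n·CΦ ×`
n-FREE numbers at an n-FREE rate — the binder pair `hArest ∕ hBrest` of `ChartDefectHead` with NO socket left but `hΓ` ∕ `hΦ`; m-uniform exactly when
`(CΓ + …)·CΦ·symMixAbs (ctr 4 n) n ≲ n¹¹`.  Asserts NO n-law of `CΓ`, `CΦ`, `symMixAbs`. -/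
theorem restRow_head {CΓ δΓ : ℝ} (hCΓ : 0 ≤ CΓ) (hδΓ : 0 ≤ δΓ)
    (hΓ : ∀ (κ : Fin (3 + 1)) (x : Site 4) (l : Fin (3 + 1)) (x' : Site 4),
      |Gam (N := n) κ x l x'| ≤ CΓ * Real.exp (-δΓ * l1 (x - x')))
    {CΦ κ₀ : ℝ} (hκ₀ : 0 < κ₀)
    (hΦ : ∀ (ρ ν : Fin (3 + 1)) (w : Fin (3 + 1) → ℤ),
      |wΦ (N := n) ρ ν w| ≤ CΦ * ((n : ℝ) ^ 5)⁻¹ * ((n : ℝ) ^ 3)⁻¹ * Real.exp (-(κ₀ * supNorm w)))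
    (cΛ : ℝ) {θ : ℝ} (hθ : 0 < θ) (μ ν : Fin (3 + 1)) :
    (∀ a e : Fin (3 + 1), AbsMoment₂ (fun z : Site 4 => (1 / 2 : ℝ) * tadpole (coDressKBmAt (ctr 4 n) n (KInvStep (d := 3) n 0))
        (mixOfK (KInvStep (d := 3) n 0) n (M2Of 3 n (symTablesAn1S2 3 n cΛ).mixFF 0) a 0 e z
          + mixOfK (KInvStep (d := 3) n 0) n (M2Of 3 n (symTablesAn1S2 3 n cΛ).mixFF 0) e z a 0))) ∧
      |B12Beta.secondMoment (fun (a e : Fin (3 + 1)) (z : Site 4) => (1 / 2 : ℝ) * tadpole (coDressKBmAt (ctr 4 n) n (KInvStep (d := 3) n 0))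
          (mixOfK (KInvStep (d := 3) n 0) n (M2Of 3 n (symTablesAn1S2 3 n cΛ).mixFF 0) a 0 e z
            + mixOfK (KInvStep (d := 3) n 0) n (M2Of 3 n (symTablesAn1S2 3 n cΛ).mixFF 0) e z a 0)) μ ν|
        ≤ ((1 / 2 : ℝ) * (((1 + 4 * (((3 : ℝ) + 1) * n)) ^ 2
              * (CΓ + (((n : ℝ) ^ 5)⁻¹ * ((MG163 4 * periodConst (kappa163 4) 3) * Real.exp (kappa163 4 / 4)))
                  + (((n : ℝ) ^ 5)⁻¹ * ((MG163 4 * periodConst (kappa163 4) 3) * Real.exp (kappa163 4 / 4)))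
                  + (CΦ * ((n : ℝ) ^ 5)⁻¹ * ((n : ℝ) ^ 3)⁻¹ * Real.exp κ₀)))
            * (2 * ((((n : ℝ) ^ 5)⁻¹ * (((n : ℝ) ^ 5)⁻¹ * ((n : ℝ) ^ 3)⁻¹))
            * (16 * ((MG163 4 * periodConst (kappa163 4) 3) * Real.exp (kappa163 4 / 4)) * (CΦ * Real.exp κ₀)
                * Real.exp (min (kappa163 4 / 4) κ₀) * Real.exp (min (kappa163 4 / 4) κ₀)
                * Zl 4 (min (kappa163 4 / 4) κ₀ / 8) * Zl 4 (θ / 2)))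
            * (symMixAbs (ctr 4 n) n * Real.exp (θ * ((3 : ℝ) + 1))))))
          * ∑' x : Site 4, l1 x ^ 2 * Real.exp (-(min (min (kappa163 4 / 4) κ₀ / 8) (θ / 2)) * l1 x) := by
  have hG := bdd_G₀_of_decays n (decays_K₀_of_blocks n hCΓ hΓ hκ₀ hΦ)
    (le_min hδΓ (le_min (by have := kappa163_pos 4; positivity) (by positivity)))
  have hS : 0 ≤ (1 + 4 * (((3 : ℝ) + 1) * n)) ^ 2
      * (CΓ + (((n : ℝ) ^ 5)⁻¹ * ((MG163 4 * periodConst (kappa163 4) 3) * Real.exp (kappa163 4 / 4)))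
          + (((n : ℝ) ^ 5)⁻¹ * ((MG163 4 * periodConst (kappa163 4) 3) * Real.exp (kappa163 4 / 4)))
          + (CΦ * ((n : ℝ) ^ 5)⁻¹ * ((n : ℝ) ^ 3)⁻¹ * Real.exp κ₀)) :=
    (abs_nonneg _).trans (hG 0 0 (Sum.inl 0) (Sum.inl 0))
  exact restRow_record_mass n hG hS hκ₀ hΦ cΛ hθ μ ν

end Record

end Summit.QuantumFields.BalabanUV.Beta.D1BFx.StraightPinRestRowMass

end
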